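import Mathlib.Analysis.SpecialFunctions.SmoothTransition
import Mathlib.Analysis.SpecialFunctions.Trigonometric.Deriv
import Mathlib.Analysis.SpecialFunctions.Complex.LogDeriv
import Mathlib.Analysis.InnerProductSpace.Calculus
import Literature.Topology.PlaneTopology.WindingNumber
import Literature.Topology.FourManifolds.SphereSimplyConnected
import Literature.Topology.FourManifolds.GluckTwist
import Literature.Topology.FourManifolds.CerfGammaFourProofs
import Literature.Topology.FourManifolds.PalaisBallComplement
import HarnessLib

/-!
# Fibre twists, the half-turn of `S²`, smooth angle functions (Gluck twist, file 3; proved)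

Third file of the decomposition of the named fact `Literature.Topology.FourManifolds.nonempty_diffeomorph_of_isGluckTwist`
(`GluckTwist.lean`; H. Gluck, Trans. AMS 104 (1962), §8). Everything here is proved. It supplies
the explicit isotopies of the tube `S² × ℝ²`, cut off radially, through which a smooth family of
orthogonal reparametrisations of the fibres — the discrepancy between two tubular neighbourhoods
of a 2-knot left by the Tubular Neighbourhood Theorem — is absorbed into diffeomorphisms of `S⁴`
(by `TwoKnot.TubularNbhd.pushforwardDiffeo` of `GluckTwistLocality.lean`):

* `Literature.tubeCutoff χ` (`= 1` on `‖w‖ ≤ 1`, `= 0` on `‖w‖ ≥ √2`), `Literature.rotPlane θ` (rotations of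
  `ℝ²`), `Literature.axisRot θ` (rotations of `S²` about the `x₀`-axis; `σ' = axisRot π` is the half-turn),
  `Literature.Topology.FourManifolds.conjPlane` (complex conjugation of `ℝ²`);
* `Literature.fibreTwist β` — the diffeomorphism `(x, w) ↦ (x, R(χ(‖w‖²) β x) w)` of `S² × ℝ²` for a smooth
  angle function `β : S² → ℝ`: rotation of the fibre over `x` by `β x` inside the unit tube, the
  identity outside the tube of radius `2`;
* `Literature.axisTwist s` — `(x, w) ↦ (axisRot (s χ(‖w‖²)) x, w)`: for `s = π` the half-turn of the
  `S²`-factor inside the unit tube, the identity outside the tube of radius `2`;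
* `Literature.halfTurnConj ι = σ' × conj` and **`Literature.Topology.FourManifolds.gluckMap_halfTurnConj`: the Gluck map commutes with
  `ι`** (`rot_{w̄} ∘ σ' = σ' ∘ rot_w`), i.e. `τ⁻¹ = ι τ ι`; with `Literature.Topology.FourManifolds.isOpenGluing_gluckRel_reparam`
  (re-gluing through a symmetry of the Gluck map) this identifies the twist by `τ⁻¹` along `K`
  with the twist by `τ` along the reparametrised knot `K ∘ σ'` — the formal content of Gluck's
  remark that `τ` and `τ⁻¹` yield the same construction (Gluck 1962, §8; cf. Aitchison–Rubinstein
  in *Four-Manifold Theory*, Contemp. Math. 35 (1984), p. 13: "up to isotopy there is only one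
  diffeomorphism of `S² × S¹` … which does not extend over `S² × D²`");
* `Literature.Topology.FourManifolds.SphereEmbedding.precomp`, `Literature.Topology.FourManifolds.TwoKnot.TubularNbhd.reparam` — reparametrised knots
  `K ∘ φ` and tubular neighbourhoods `ν ∘ Φ`;
* **`Literature.Topology.FourManifolds.exists_contMDiff_angle`** — a smooth map `S² → S¹` has a smooth angle function (lifting
  criterion, `π₁(S²) = 1`: Mathlib's `Complex.exists_continuousOn_eqOn_exp_comp` and the tree's
  `simplyConnectedSpace_euclideanSphere`; smoothness by comparison with local branches of `log`);
* **`Literature.Topology.FourManifolds.exists_angle_of_linearIsometry_family`** — a smooth family `g : S² → O(2)` is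
  `x ↦ R(β x)` or `x ↦ R(β x) ∘ conj` for a smooth `β` (the determinant is locally constant), the
  `π₂(O(2)) = 0`-type input.

## References

* H. Gluck, *The embedding of two-spheres in the four-sphere*, Trans. Amer. Math. Soc. 104 (1962)
  308–333, §8 [GluckTAMS1962].
* I. R. Aitchison, J. H. Rubinstein, *Fibered knots and involutions on homotopy spheres*, in
  *Four-Manifold Theory* (C. Gordon, R. Kirby eds.), Contemp. Math. 35, AMS (1984), p. 13.
* A. Hatcher, *Algebraic Topology*, CUP (2002), Prop. 1.33 (lifting criterion).

## Design notes

* Smoothness of maps into `ℝ²`, `ℝ³` built from coordinates is proved "structurally"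
  (`ContMDiff.smul/.add`, `contMDiff_coe_sphere`, `ContMDiff.codRestrict_sphere`), following
  `rotateSphereTwo` in `GluckTwist.lean`.
* No declaration in this file uses `sorry`.
-/

open scoped Manifold ContDiff Topology Real
open Function Set

noncomputable section

namespace Literature.Topology.FourManifolds

/-- Local notation: `𝔼 n` is the model Euclidean space `EuclideanSpace ℝ (Fin n)`. -/
local notation "𝔼 " n:arg => EuclideanSpace ℝ (Fin n)

/-- Local notation: `𝕊 n` is the unit sphere in `EuclideanSpace ℝ (Fin (n + 1))`. -/
local notation "𝕊 " n:arg => (Metric.sphere (0 : EuclideanSpace ℝ (Fin (n + 1))) 1)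

/-! ### A cutoff in the fibre direction -/

section Cutoff

/-- The **tube cutoff** `χ : ℝ → [0, 1]`, smooth, `χ = 1` on `(-∞, 1]` and `χ = 0` on `[2, ∞)`
(from Mathlib's `Real.smoothTransition`). Fed with `‖w‖²` it localises fibrewise isotopies of
`S² × ℝ²` to the tube `‖w‖ ≤ √2`. [folklore] -/
def tubeCutoff (t : ℝ) : ℝ := 1 - Real.smoothTransition (t - 1)

/-- `χ = 1` on `(-∞, 1]`. [folklore] -/
theorem tubeCutoff_of_le_one {t : ℝ} (h : t ≤ 1) : tubeCutoff t = 1 := by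
  rw [tubeCutoff, Real.smoothTransition.zero_of_nonpos (by linarith), sub_zero]

/-- `χ = 0` on `[2, ∞)`. [folklore] -/
theorem tubeCutoff_of_two_le {t : ℝ} (h : 2 ≤ t) : tubeCutoff t = 0 := by
  rw [tubeCutoff, Real.smoothTransition.one_of_one_le (by linarith), sub_self]

/-- The cutoff is smooth. [folklore] -/
theorem contDiff_tubeCutoff : ContDiff ℝ ∞ tubeCutoff :=
  contDiff_const.sub ((Real.smoothTransition.contDiff (n := ⊤)).comp (contDiff_id.sub contDiff_const))

/-- The cutoff `w ↦ χ (‖w‖²)` on the plane is smooth. [folklore] -/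
theorem contDiff_tubeCutoff_norm_sq : ContDiff ℝ ∞ fun w : 𝔼 2 => tubeCutoff (‖w‖ ^ 2) :=
  contDiff_tubeCutoff.comp (contDiff_norm_sq ℝ)

/-- `χ (‖w‖²) = 1` for `‖w‖ ≤ 1`. [folklore] -/
theorem tubeCutoff_norm_sq_of_norm_le_one {w : 𝔼 2} (h : ‖w‖ ≤ 1) : tubeCutoff (‖w‖ ^ 2) = 1 :=
  tubeCutoff_of_le_one (by nlinarith [norm_nonneg w])

/-- `χ (‖w‖²) = 0` for `2 ≤ ‖w‖`. [folklore] -/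
theorem tubeCutoff_norm_sq_of_two_le_norm {w : 𝔼 2} (h : 2 ≤ ‖w‖) : tubeCutoff (‖w‖ ^ 2) = 0 :=
  tubeCutoff_of_two_le (by nlinarith [norm_nonneg w])

end Cutoff

/-! ### Rotations of the plane -/

section PlaneRot

/-- The **rotation of the plane `ℝ²` through the angle `θ`**:
`(w₀, w₁) ↦ (cos θ w₀ - sin θ w₁, sin θ w₀ + cos θ w₁)`. [folklore] -/
def rotPlane (θ : ℝ) (w : 𝔼 2) : 𝔼 2 :=
  WithLp.toLp 2 ![Real.cos θ * w 0 - Real.sin θ * w 1, Real.sin θ * w 0 + Real.cos θ * w 1]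

/-- First coordinate of a rotated vector. [folklore] -/
@[simp]
theorem rotPlane_apply_zero (θ : ℝ) (w : 𝔼 2) :
    rotPlane θ w 0 = Real.cos θ * w 0 - Real.sin θ * w 1 := rfl

/-- Second coordinate of a rotated vector. [folklore] -/
@[simp]
theorem rotPlane_apply_one (θ : ℝ) (w : 𝔼 2) :
    rotPlane θ w 1 = Real.sin θ * w 0 + Real.cos θ * w 1 := rfl

/-- Rotation through `0` is the identity. [folklore] -/
@[simp]
theorem rotPlane_zero (w : 𝔼 2) : rotPlane 0 w = w := by
  ext i
  fin_cases i <;> simp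

/-- Rotations compose by adding angles. [folklore] -/
theorem rotPlane_add (θ θ' : ℝ) (w : 𝔼 2) : rotPlane (θ + θ') w = rotPlane θ (rotPlane θ' w) := by
  ext i
  fin_cases i
  · simp only [Fin.zero_eta, rotPlane_apply_zero, rotPlane_apply_one, Real.cos_add, Real.sin_add]
    ring
  · simp only [Fin.mk_one, rotPlane_apply_zero, rotPlane_apply_one, Real.cos_add, Real.sin_add]
    ring

/-- Rotating back. [folklore] -/
@[simp]
theorem rotPlane_neg_rotPlane (θ : ℝ) (w : 𝔼 2) : rotPlane (-θ) (rotPlane θ w) = w := by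
  rw [← rotPlane_add, neg_add_cancel, rotPlane_zero]

/-- Rotating forth. [folklore] -/
@[simp]
theorem rotPlane_rotPlane_neg (θ : ℝ) (w : 𝔼 2) : rotPlane θ (rotPlane (-θ) w) = w := by
  rw [← rotPlane_add, add_neg_cancel, rotPlane_zero]

/-- Rotations fix the origin. [folklore] -/
@[simp]
theorem rotPlane_apply_zero_vec (θ : ℝ) : rotPlane θ 0 = 0 := by
  ext i
  fin_cases i <;> simp

/-- Rotations preserve the norm. [folklore] -/
@[simp]
theorem norm_rotPlane (θ : ℝ) (w : 𝔼 2) : ‖rotPlane θ w‖ = ‖w‖ := by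
  have hcs := Real.cos_sq_add_sin_sq θ
  rw [EuclideanSpace.norm_eq, EuclideanSpace.norm_eq, Fin.sum_univ_two, Fin.sum_univ_two]
  congr 1
  simp only [Real.norm_eq_abs, sq_abs, rotPlane_apply_zero, rotPlane_apply_one]
  linear_combination (w 0 ^ 2 + w 1 ^ 2) * hcs

/-- A rotated vector vanishes iff the vector does. [folklore] -/
theorem rotPlane_eq_zero_iff (θ : ℝ) (w : 𝔼 2) : rotPlane θ w = 0 ↔ w = 0 := by
  rw [← norm_eq_zero, norm_rotPlane, norm_eq_zero]

/-- The rotation is jointly smooth in the angle and the vector. [folklore] -/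
theorem contDiff_rotPlane : ContDiff ℝ ∞ fun q : ℝ × 𝔼 2 => rotPlane q.1 q.2 := by
  unfold rotPlane
  apply PiLp.contDiff_toLp.comp
  rw [contDiff_pi]
  have h0 : ContDiff ℝ ∞ fun q : ℝ × 𝔼 2 => q.2 0 :=
    (EuclideanSpace.proj (𝕜 := ℝ) (0 : Fin 2)).contDiff.comp contDiff_snd
  have h1 : ContDiff ℝ ∞ fun q : ℝ × 𝔼 2 => q.2 1 :=
    (EuclideanSpace.proj (𝕜 := ℝ) (1 : Fin 2)).contDiff.comp contDiff_snd
  have hc : ContDiff ℝ ∞ fun q : ℝ × 𝔼 2 => Real.cos q.1 := Real.contDiff_cos.comp contDiff_fst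
  have hs : ContDiff ℝ ∞ fun q : ℝ × 𝔼 2 => Real.sin q.1 := Real.contDiff_sin.comp contDiff_fst
  intro i
  fin_cases i
  · exact (hc.mul h0).sub (hs.mul h1)
  · exact (hs.mul h0).add (hc.mul h1)

/-- Rotations are homogeneous: `R(θ) (t w) = t R(θ) w`. [folklore] -/
theorem rotPlane_smul (θ t : ℝ) (w : 𝔼 2) : rotPlane θ (t • w) = t • rotPlane θ w := by
  ext i
  fin_cases i <;> simp <;> ring

end PlaneRot

/-! ### The fibre twist of `S² × ℝ²` by an angle function -/

section FibreTwist

variable (β : (𝕊 2) → ℝ)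

/-- The **fibre twist** of `S² × ℝ²` by the angle function `β : S² → ℝ`, cut off in the fibre:
`(x, w) ↦ (x, R(χ(‖w‖²) β x) w)`. It rotates the fibre over `x` by the angle `β x` inside the unit
tube and is the identity outside the tube of radius `2`. [folklore] -/
def fibreTwistFun (p : (𝕊 2) × 𝔼 2) : (𝕊 2) × 𝔼 2 :=
  (p.1, rotPlane (tubeCutoff (‖p.2‖ ^ 2) * β p.1) p.2)

/-- First component of the fibre twist. [folklore] -/
@[simp]
theorem fibreTwistFun_fst (p : (𝕊 2) × 𝔼 2) : (fibreTwistFun β p).1 = p.1 := rfl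

/-- Second component of the fibre twist. [folklore] -/
theorem fibreTwistFun_snd (p : (𝕊 2) × 𝔼 2) :
    (fibreTwistFun β p).2 = rotPlane (tubeCutoff (‖p.2‖ ^ 2) * β p.1) p.2 := rfl

/-- The fibre twist preserves the fibre norm. [folklore] -/
@[simp]
theorem norm_fibreTwistFun_snd (p : (𝕊 2) × 𝔼 2) : ‖(fibreTwistFun β p).2‖ = ‖p.2‖ := by
  simp [fibreTwistFun_snd]

/-- The fibre twist by `-β` undoes the fibre twist by `β`. [folklore] -/
theorem fibreTwistFun_neg_fibreTwistFun (p : (𝕊 2) × 𝔼 2) :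
    fibreTwistFun (fun x => -β x) (fibreTwistFun β p) = p := by
  obtain ⟨x, w⟩ := p
  simp only [fibreTwistFun, norm_rotPlane, mul_neg, rotPlane_neg_rotPlane]

/-- Outside the tube of radius `2` the fibre twist is the identity. [folklore] -/
theorem fibreTwistFun_of_two_le {p : (𝕊 2) × 𝔼 2} (h : 2 ≤ ‖p.2‖) : fibreTwistFun β p = p := by
  obtain ⟨x, w⟩ := p
  simp only [fibreTwistFun, tubeCutoff_norm_sq_of_two_le_norm h, zero_mul, rotPlane_zero]

/-- Inside the unit tube the fibre twist rotates the fibre over `x` by `β x`. [folklore] -/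
theorem fibreTwistFun_of_norm_le_one {p : (𝕊 2) × 𝔼 2} (h : ‖p.2‖ ≤ 1) :
    fibreTwistFun β p = (p.1, rotPlane (β p.1) p.2) := by
  obtain ⟨x, w⟩ := p
  simp only [fibreTwistFun, tubeCutoff_norm_sq_of_norm_le_one h, one_mul]

/-- The fibre twist fixes the zero section. [folklore] -/
@[simp]
theorem fibreTwistFun_zero (x : 𝕊 2) : fibreTwistFun β (x, 0) = (x, 0) := by
  simp [fibreTwistFun]

variable {β}

/-- The radial cutoff `(x, w) ↦ χ(‖w‖²)` on `S² × ℝ²` is smooth. [folklore] -/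
theorem contMDiff_tubeCutoff_fibre :
    ContMDiff ((𝓡 2).prod 𝓘(ℝ, 𝔼 2)) 𝓘(ℝ, ℝ) ∞
      fun p : (𝕊 2) × 𝔼 2 => tubeCutoff (‖p.2‖ ^ 2) :=
  contDiff_tubeCutoff_norm_sq.contMDiff.comp contMDiff_snd

/-- The cut-off angle `(x, w) ↦ χ(‖w‖²) β x` is smooth for smooth `β`. [folklore] -/
theorem contMDiff_tubeCutoff_mul (hβ : ContMDiff (𝓡 2) 𝓘(ℝ, ℝ) ∞ β) :
    ContMDiff ((𝓡 2).prod 𝓘(ℝ, 𝔼 2)) 𝓘(ℝ, ℝ) ∞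
      fun p : (𝕊 2) × 𝔼 2 => tubeCutoff (‖p.2‖ ^ 2) * β p.1 :=
  contMDiff_tubeCutoff_fibre.smul (hβ.comp contMDiff_fst)

/-- The quarter turn `J (w₀, w₁) = (-w₁, w₀)` of the plane. [folklore] -/
def quarterTurn (w : 𝔼 2) : 𝔼 2 := WithLp.toLp 2 ![-(w 1), w 0]

/-- A rotation is `cos θ • id + sin θ • J`. [folklore] -/
theorem rotPlane_eq_smul_add (θ : ℝ) (w : 𝔼 2) :
    rotPlane θ w = Real.cos θ • w + Real.sin θ • quarterTurn w := by
  ext i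
  fin_cases i <;> simp [quarterTurn] <;> ring

/-- The quarter turn is smooth (it is linear). [folklore] -/
theorem contDiff_quarterTurn : ContDiff ℝ ∞ quarterTurn := by
  unfold quarterTurn
  apply PiLp.contDiff_toLp.comp
  rw [contDiff_pi]
  intro i
  fin_cases i <;> simp <;> fun_prop

/-- The second component of the fibre twist is smooth for smooth `β` (written as
`cos (χ β) • w + sin (χ β) • J w`). [folklore] -/
theorem contMDiff_fibreTwistFun_snd (hβ : ContMDiff (𝓡 2) 𝓘(ℝ, ℝ) ∞ β) :
    ContMDiff ((𝓡 2).prod 𝓘(ℝ, 𝔼 2)) 𝓘(ℝ, 𝔼 2) ∞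
      fun p : (𝕊 2) × 𝔼 2 => rotPlane (tubeCutoff (‖p.2‖ ^ 2) * β p.1) p.2 := by
  have ha := contMDiff_tubeCutoff_mul hβ
  have hc : ContMDiff ((𝓡 2).prod 𝓘(ℝ, 𝔼 2)) 𝓘(ℝ, ℝ) ∞
      fun p : (𝕊 2) × 𝔼 2 => Real.cos (tubeCutoff (‖p.2‖ ^ 2) * β p.1) :=
    Real.contDiff_cos.contMDiff.comp ha
  have hs : ContMDiff ((𝓡 2).prod 𝓘(ℝ, 𝔼 2)) 𝓘(ℝ, ℝ) ∞
      fun p : (𝕊 2) × 𝔼 2 => Real.sin (tubeCutoff (‖p.2‖ ^ 2) * β p.1) :=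
    Real.contDiff_sin.contMDiff.comp ha
  have hJ : ContMDiff ((𝓡 2).prod 𝓘(ℝ, 𝔼 2)) 𝓘(ℝ, 𝔼 2) ∞
      fun p : (𝕊 2) × 𝔼 2 => quarterTurn p.2 :=
    contDiff_quarterTurn.contMDiff.comp contMDiff_snd
  exact ((hc.smul contMDiff_snd).add (hs.smul hJ)).congr fun p => rotPlane_eq_smul_add _ _

/-- The fibre twist by a smooth angle function is smooth. [folklore] -/
theorem contMDiff_fibreTwistFun (hβ : ContMDiff (𝓡 2) 𝓘(ℝ, ℝ) ∞ β) :
    ContMDiff ((𝓡 2).prod 𝓘(ℝ, 𝔼 2)) ((𝓡 2).prod 𝓘(ℝ, 𝔼 2)) ∞ (fibreTwistFun β) :=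
  contMDiff_fst.prodMk (contMDiff_fibreTwistFun_snd hβ)

/-- The **fibre twist diffeomorphism** of `S² × ℝ²` by a smooth angle function `β` (inverse: the
fibre twist by `-β`). It is the identity outside the tube of radius `2` and rotates the fibre over
`x` by `β x` inside the unit tube: an explicit fibrewise isotopy, cut off radially, from the
bundle automorphism `(x, w) ↦ (x, R(β x) w)` to the identity. [folklore] -/
def fibreTwist (β : (𝕊 2) → ℝ) (hβ : ContMDiff (𝓡 2) 𝓘(ℝ, ℝ) ∞ β) :
    ((𝕊 2) × 𝔼 2) ≃ₘ⟮(𝓡 2).prod 𝓘(ℝ, 𝔼 2), (𝓡 2).prod 𝓘(ℝ, 𝔼 2)⟯ ((𝕊 2) × 𝔼 2) where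
  toFun := fibreTwistFun β
  invFun := fibreTwistFun fun x => -β x
  left_inv := fibreTwistFun_neg_fibreTwistFun β
  right_inv p := by
    have h := fibreTwistFun_neg_fibreTwistFun (fun x => -β x) p
    simpa only [neg_neg] using h
  contMDiff_toFun := contMDiff_fibreTwistFun (β := β) hβ
  contMDiff_invFun := by
    have hβ' : ContMDiff (𝓡 2) 𝓘(ℝ, ℝ) ∞ fun x => -β x := hβ.neg
    exact contMDiff_fibreTwistFun (β := fun x => -β x) hβ'

/-- The fibre twist diffeomorphism as a function. [folklore] -/
@[simp]
theorem coe_fibreTwist (hβ : ContMDiff (𝓡 2) 𝓘(ℝ, ℝ) ∞ β) : ⇑(fibreTwist β hβ) = fibreTwistFun β :=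
  rfl

end FibreTwist

/-! ### Rotations of `S²` about the `x₀`-axis and the half-turn -/

section AxisRot

/-- The **rotation of `S²` about the `x₀`-axis** through the angle `θ`:
`(x₀, x₁, x₂) ↦ (x₀, cos θ x₁ - sin θ x₂, sin θ x₁ + cos θ x₂)`. For `θ = π` this is the half-turn
`(x₀, x₁, x₂) ↦ (x₀, -x₁, -x₂)`, an orientation-preserving involution of `S²` conjugating the
rotation `rotateSphereTwo u` about the `x₂`-axis into its inverse. [folklore] -/
def axisRot (θ : ℝ) (x : 𝕊 2) : 𝕊 2 :=
  ⟨WithLp.toLp 2 ![(x : 𝔼 3) 0, Real.cos θ * (x : 𝔼 3) 1 - Real.sin θ * (x : 𝔼 3) 2,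
      Real.sin θ * (x : 𝔼 3) 1 + Real.cos θ * (x : 𝔼 3) 2], by
    have hx := norm_eq_of_mem_sphere x
    have hcs := Real.cos_sq_add_sin_sq θ
    rw [EuclideanSpace.norm_eq, Real.sqrt_eq_one, Fin.sum_univ_three] at hx
    rw [mem_sphere_zero_iff_norm, EuclideanSpace.norm_eq, Real.sqrt_eq_one, Fin.sum_univ_three]
    simp only [Real.norm_eq_abs, sq_abs] at hx ⊢
    simp only [Matrix.cons_val_zero, Matrix.cons_val_one, Matrix.cons_val]
    linear_combination ((x : 𝔼 3) 1 ^ 2 + (x : 𝔼 3) 2 ^ 2) * hcs + hx⟩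

/-- Coordinates of the axis rotation: the axis coordinate is fixed. [folklore] -/
@[simp]
theorem axisRot_apply_zero (θ : ℝ) (x : 𝕊 2) : (axisRot θ x : 𝔼 3) 0 = (x : 𝔼 3) 0 := rfl

/-- Coordinates of the axis rotation: second coordinate. [folklore] -/
@[simp]
theorem axisRot_apply_one (θ : ℝ) (x : 𝕊 2) :
    (axisRot θ x : 𝔼 3) 1 = Real.cos θ * (x : 𝔼 3) 1 - Real.sin θ * (x : 𝔼 3) 2 := rfl

/-- Coordinates of the axis rotation: third coordinate. [folklore] -/
@[simp]
theorem axisRot_apply_two (θ : ℝ) (x : 𝕊 2) :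
    (axisRot θ x : 𝔼 3) 2 = Real.sin θ * (x : 𝔼 3) 1 + Real.cos θ * (x : 𝔼 3) 2 := rfl

/-- Rotation through `0` is the identity. [folklore] -/
@[simp]
theorem axisRot_zero (x : 𝕊 2) : axisRot 0 x = x := by
  apply Subtype.ext
  ext i
  fin_cases i <;> simp

/-- Axis rotations compose by adding angles. [folklore] -/
theorem axisRot_add (θ θ' : ℝ) (x : 𝕊 2) : axisRot (θ + θ') x = axisRot θ (axisRot θ' x) := by
  apply Subtype.ext
  ext i
  fin_cases i
  · rfl
  · simp only [Fin.mk_one, axisRot_apply_one, axisRot_apply_two, Real.cos_add, Real.sin_add]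
    ring
  · simp only [Fin.reduceFinMk, axisRot_apply_two, axisRot_apply_one, Real.cos_add, Real.sin_add]
    ring

/-- Rotating back. [folklore] -/
@[simp]
theorem axisRot_neg_axisRot (θ : ℝ) (x : 𝕊 2) : axisRot (-θ) (axisRot θ x) = x := by
  rw [← axisRot_add, neg_add_cancel, axisRot_zero]

/-- Rotating forth. [folklore] -/
@[simp]
theorem axisRot_axisRot_neg (θ : ℝ) (x : 𝕊 2) : axisRot θ (axisRot (-θ) x) = x := by
  rw [← axisRot_add, add_neg_cancel, axisRot_zero]

/-- The trilinear model `ℝ × ℝ³ → ℝ³` of the axis rotation (for smoothness). [folklore] -/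
def axisRotAux (q : ℝ × 𝔼 3) : 𝔼 3 :=
  WithLp.toLp 2 ![q.2 0, Real.cos q.1 * q.2 1 - Real.sin q.1 * q.2 2,
    Real.sin q.1 * q.2 1 + Real.cos q.1 * q.2 2]

/-- The model map is smooth. [folklore] -/
theorem contDiff_axisRotAux : ContDiff ℝ ∞ axisRotAux := by
  unfold axisRotAux
  apply PiLp.contDiff_toLp.comp
  rw [contDiff_pi]
  have h : ∀ j : Fin 3, ContDiff ℝ ∞ fun q : ℝ × 𝔼 3 => q.2 j := fun j =>
    (EuclideanSpace.proj (𝕜 := ℝ) j).contDiff.comp contDiff_snd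
  have hc : ContDiff ℝ ∞ fun q : ℝ × 𝔼 3 => Real.cos q.1 := Real.contDiff_cos.comp contDiff_fst
  have hs : ContDiff ℝ ∞ fun q : ℝ × 𝔼 3 => Real.sin q.1 := Real.contDiff_sin.comp contDiff_fst
  intro i
  fin_cases i
  · exact h 0
  · exact (hc.mul (h 1)).sub (hs.mul (h 2))
  · exact (hs.mul (h 1)).add (hc.mul (h 2))

/-- `axisRot` is the restriction of `axisRotAux`. [folklore] -/
theorem coe_axisRot (θ : ℝ) (x : 𝕊 2) : (axisRot θ x : 𝔼 3) = axisRotAux (θ, (x : 𝔼 3)) := rfl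

/-- The axis rotation is jointly smooth in the angle and the point. [folklore] -/
theorem contMDiff_axisRot :
    ContMDiff (𝓘(ℝ, ℝ).prod (𝓡 2)) (𝓡 2) ∞ fun q : ℝ × (𝕊 2) => axisRot q.1 q.2 := by
  haveI := Fact.mk (@finrank_euclideanSpace_fin ℝ _ (2 + 1))
  have h1 : ContMDiff (𝓘(ℝ, ℝ).prod (𝓡 2)) 𝓘(ℝ, 𝔼 3) ∞ fun q : ℝ × (𝕊 2) => (q.2 : 𝔼 3) :=
    contMDiff_coe_sphere.comp contMDiff_snd
  have h : ContMDiff (𝓘(ℝ, ℝ).prod (𝓡 2)) 𝓘(ℝ, 𝔼 3) ∞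
      fun q : ℝ × (𝕊 2) => (axisRot q.1 q.2 : 𝔼 3) :=
    contDiff_axisRotAux.contMDiff.comp (contMDiff_fst.prodMk_space h1)
  exact h.codRestrict_sphere fun q => (axisRot q.1 q.2).2

/-- For a fixed angle the axis rotation is smooth. [folklore] -/
theorem contMDiff_axisRot_right (θ : ℝ) : ContMDiff (𝓡 2) (𝓡 2) ∞ (axisRot θ) :=
  contMDiff_axisRot.comp (contMDiff_const.prodMk contMDiff_id)

/-- The axis rotation through a fixed angle as a **diffeomorphism of `S²`** (inverse: the rotation
through `-θ`). [folklore] -/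
def axisRotDiffeo (θ : ℝ) : (𝕊 2) ≃ₘ⟮𝓡 2, 𝓡 2⟯ (𝕊 2) where
  toFun := axisRot θ
  invFun := axisRot (-θ)
  left_inv := axisRot_neg_axisRot θ
  right_inv := axisRot_axisRot_neg θ
  contMDiff_toFun := contMDiff_axisRot_right θ
  contMDiff_invFun := contMDiff_axisRot_right (-θ)

/-- The axis rotation diffeomorphism as a function. [folklore] -/
@[simp]
theorem coe_axisRotDiffeo (θ : ℝ) : ⇑(axisRotDiffeo θ) = axisRot θ := rfl

/-- **The half-turn conjugates `rot_u` into `rot_ū`**: rotating `S²` by `π` about the `x₀`-axis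
reverses the `x₂`-axis and hence the sense of the rotations `rotateSphereTwo u` about it:
`rot_ū (σ' x) = σ' (rot_u x)` with `σ' = axisRot π`, `ū = (u₀, -u₁)`. This identity is why the
Gluck twists by `τ` and by `τ⁻¹` coincide. [folklore] -/
theorem rotateSphereTwo_conj_axisRot_pi (u : 𝕊 1) (x : 𝕊 2) :
    rotateSphereTwo ⟨_, conj_mem_sphere u⟩ (axisRot π x) = axisRot π (rotateSphereTwo u x) := by
  apply Subtype.ext
  ext i
  fin_cases i
  · simp
  · simp only [Fin.mk_one, rotateSphereTwo_apply_one, axisRot_apply_zero, axisRot_apply_one,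
      Real.cos_pi, Real.sin_pi]
    simp
    ring
  · simp

end AxisRot

/-! ### The axis twist of `S² × ℝ²` (half-turn of the `S²` factor, cut off in the fibre) -/

section SphereTwist

/-- The **axis twist** of `S² × ℝ²`: rotate the `S²`-factor about the `x₀`-axis through the
angle `π χ(‖w‖²)`, i.e. by the half-turn `σ'` inside the unit tube and not at all outside the tube
of radius `2`. [folklore] -/
def axisTwistFun (s : ℝ) (p : (𝕊 2) × 𝔼 2) : (𝕊 2) × 𝔼 2 :=
  (axisRot (s * tubeCutoff (‖p.2‖ ^ 2)) p.1, p.2)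

/-- Second component of the axis twist. [folklore] -/
@[simp]
theorem axisTwistFun_snd (s : ℝ) (p : (𝕊 2) × 𝔼 2) : (axisTwistFun s p).2 = p.2 := rfl

/-- First component of the axis twist. [folklore] -/
theorem axisTwistFun_fst (s : ℝ) (p : (𝕊 2) × 𝔼 2) :
    (axisTwistFun s p).1 = axisRot (s * tubeCutoff (‖p.2‖ ^ 2)) p.1 := rfl

/-- The axis twist by `-s` undoes the axis twist by `s`. [folklore] -/
theorem axisTwistFun_neg_axisTwistFun (s : ℝ) (p : (𝕊 2) × 𝔼 2) :
    axisTwistFun (-s) (axisTwistFun s p) = p := by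
  obtain ⟨x, w⟩ := p
  simp only [axisTwistFun, neg_mul, axisRot_neg_axisRot]

/-- Outside the tube of radius `2` the axis twist is the identity. [folklore] -/
theorem axisTwistFun_of_two_le (s : ℝ) {p : (𝕊 2) × 𝔼 2} (h : 2 ≤ ‖p.2‖) :
    axisTwistFun s p = p := by
  obtain ⟨x, w⟩ := p
  simp only [axisTwistFun, tubeCutoff_norm_sq_of_two_le_norm h, mul_zero, axisRot_zero]

/-- Inside the unit tube the axis twist rotates `S²` through `s`. [folklore] -/
theorem axisTwistFun_of_norm_le_one (s : ℝ) {p : (𝕊 2) × 𝔼 2} (h : ‖p.2‖ ≤ 1) :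
    axisTwistFun s p = (axisRot s p.1, p.2) := by
  obtain ⟨x, w⟩ := p
  simp only [axisTwistFun, tubeCutoff_norm_sq_of_norm_le_one h, mul_one]

/-- The cut-off angle `(x, w) ↦ s χ(‖w‖²)` is smooth. [folklore] -/
theorem contMDiff_const_mul_tubeCutoff (s : ℝ) :
    ContMDiff ((𝓡 2).prod 𝓘(ℝ, 𝔼 2)) 𝓘(ℝ, ℝ) ∞
      fun p : (𝕊 2) × 𝔼 2 => s * tubeCutoff (‖p.2‖ ^ 2) :=
  (contMDiff_const : ContMDiff ((𝓡 2).prod 𝓘(ℝ, 𝔼 2)) 𝓘(ℝ, ℝ) ∞ fun _ : (𝕊 2) × 𝔼 2 => s).smul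
    contMDiff_tubeCutoff_fibre

/-- The axis twist is smooth. [folklore] -/
theorem contMDiff_axisTwistFun (s : ℝ) :
    ContMDiff ((𝓡 2).prod 𝓘(ℝ, 𝔼 2)) ((𝓡 2).prod 𝓘(ℝ, 𝔼 2)) ∞ (axisTwistFun s) :=
  (contMDiff_axisRot.comp ((contMDiff_const_mul_tubeCutoff s).prodMk contMDiff_fst)).prodMk
    contMDiff_snd

/-- The **axis twist diffeomorphism** of `S² × ℝ²` (inverse: the axis twist by `-s`). For
`s = π` it is the half-turn `σ' × id` inside the unit tube and the identity outside the tube of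
radius `2`: an explicit isotopy, cut off radially, from `σ' × id` to the identity. [folklore] -/
def axisTwist (s : ℝ) :
    ((𝕊 2) × 𝔼 2) ≃ₘ⟮(𝓡 2).prod 𝓘(ℝ, 𝔼 2), (𝓡 2).prod 𝓘(ℝ, 𝔼 2)⟯ ((𝕊 2) × 𝔼 2) where
  toFun := axisTwistFun s
  invFun := axisTwistFun (-s)
  left_inv := axisTwistFun_neg_axisTwistFun s
  right_inv p := by
    have h := axisTwistFun_neg_axisTwistFun (-s) p
    simpa only [neg_neg] using h
  contMDiff_toFun := contMDiff_axisTwistFun s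
  contMDiff_invFun := contMDiff_axisTwistFun (-s)

/-- The axis twist diffeomorphism as a function. [folklore] -/
@[simp]
theorem coe_axisTwist (s : ℝ) : ⇑(axisTwist s) = axisTwistFun s := rfl

end SphereTwist

/-! ### Conjugation of the plane and the half-turn-and-conjugate involution -/

section Conj

/-- The **conjugation of the plane** `(w₀, w₁) ↦ (w₀, -w₁)` (reflection in the `w₀`-axis; complex
conjugation on `ℝ² = ℂ`). [folklore] -/
def conjPlane (w : 𝔼 2) : 𝔼 2 := WithLp.toLp 2 ![w 0, -(w 1)]

/-- First coordinate of the conjugate. [folklore] -/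
@[simp]
theorem conjPlane_apply_zero (w : 𝔼 2) : conjPlane w 0 = w 0 := rfl

/-- Second coordinate of the conjugate. [folklore] -/
@[simp]
theorem conjPlane_apply_one (w : 𝔼 2) : conjPlane w 1 = -(w 1) := rfl

/-- Conjugation is an involution. [folklore] -/
@[simp]
theorem conjPlane_conjPlane (w : 𝔼 2) : conjPlane (conjPlane w) = w := by
  ext i
  fin_cases i <;> simp

/-- Conjugation preserves the norm. [folklore] -/
@[simp]
theorem norm_conjPlane (w : 𝔼 2) : ‖conjPlane w‖ = ‖w‖ := by
  rw [EuclideanSpace.norm_eq, EuclideanSpace.norm_eq, Fin.sum_univ_two, Fin.sum_univ_two]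
  simp

/-- Conjugation is linear (homogeneity). [folklore] -/
theorem conjPlane_smul (t : ℝ) (w : 𝔼 2) : conjPlane (t • w) = t • conjPlane w := by
  ext i
  fin_cases i <;> simp

/-- Conjugation fixes the origin. [folklore] -/
@[simp]
theorem conjPlane_zero : conjPlane 0 = 0 := by
  ext i
  fin_cases i <;> simp

/-- A conjugate vanishes iff the vector does. [folklore] -/
theorem conjPlane_eq_zero_iff (w : 𝔼 2) : conjPlane w = 0 ↔ w = 0 := by
  rw [← norm_eq_zero, norm_conjPlane, norm_eq_zero]

/-- Conjugation is smooth. [folklore] -/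
theorem contDiff_conjPlane : ContDiff ℝ ∞ conjPlane := by
  unfold conjPlane
  apply PiLp.contDiff_toLp.comp
  rw [contDiff_pi]
  intro i
  fin_cases i <;> simp <;> fun_prop

/-- Conjugation as a **diffeomorphism of the plane**. [folklore] -/
def conjPlaneDiffeo : (𝔼 2) ≃ₘ⟮𝓘(ℝ, 𝔼 2), 𝓘(ℝ, 𝔼 2)⟯ (𝔼 2) where
  toFun := conjPlane
  invFun := conjPlane
  left_inv := conjPlane_conjPlane
  right_inv := conjPlane_conjPlane
  contMDiff_toFun := contDiff_conjPlane.contMDiff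
  contMDiff_invFun := contDiff_conjPlane.contMDiff

/-- The conjugation diffeomorphism as a function. [folklore] -/
@[simp]
theorem coe_conjPlaneDiffeo : ⇑conjPlaneDiffeo = conjPlane := rfl

/-- The unit vector of the conjugate is the conjugate unit vector. [folklore] -/
theorem unitVector_conjPlane (w : 𝔼 2) (hw : w ≠ 0)
    (hw' : conjPlane w ≠ 0 := fun h => hw ((conjPlane_eq_zero_iff w).1 h)) :
    unitVector (conjPlane w) hw' = ⟨_, conj_mem_sphere (unitVector w hw)⟩ := by
  apply Subtype.ext
  ext i
  fin_cases i <;> simp [norm_conjPlane]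

/-- The **half-turn-and-conjugate involution** `ι (x, w) = (σ' x, w̄)` of `S² × ℝ²`, with `σ'` the
half-turn of `S²` about the `x₀`-axis and `w̄` complex conjugation. It commutes with the Gluck map
(`gluckMap_halfTurnConj`): this expresses `τ⁻¹ = ι ∘ τ ∘ ι`. [folklore] -/
def halfTurnConj :
    ((𝕊 2) × 𝔼 2) ≃ₘ⟮(𝓡 2).prod 𝓘(ℝ, 𝔼 2), (𝓡 2).prod 𝓘(ℝ, 𝔼 2)⟯ ((𝕊 2) × 𝔼 2) :=
  (axisRotDiffeo π).prodCongr conjPlaneDiffeo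

/-- The involution `ι` as a function. [folklore] -/
@[simp]
theorem halfTurnConj_apply (p : (𝕊 2) × 𝔼 2) : halfTurnConj p = (axisRot π p.1, conjPlane p.2) :=
  rfl

/-- **The Gluck map commutes with `ι`**: `τ (σ' x, w̄) = ι (τ (x, w))`, since
`rot_{w̄/‖w‖} ∘ σ' = σ' ∘ rot_{w/‖w‖}` (`rotateSphereTwo_conj_axisRot_pi`). [folklore] -/
theorem gluckMap_halfTurnConj (p : (𝕊 2) × 𝔼 2) :
    gluckMap (halfTurnConj p) = halfTurnConj (gluckMap p) := by
  obtain ⟨x, w⟩ := p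
  by_cases hw : w = 0
  · subst hw
    simp
  · have hw' : conjPlane w ≠ 0 := fun h => hw ((conjPlane_eq_zero_iff w).1 h)
    rw [halfTurnConj_apply, gluckMap_apply_of_ne_zero _ hw', gluckMap_apply_of_ne_zero x hw,
      halfTurnConj_apply, unitVector_conjPlane w hw, rotateSphereTwo_conj_axisRot_pi]

/-- `ι` fixes the zero section over the half-turn: `ι (x, 0) = (σ' x, 0)`. [folklore] -/
theorem halfTurnConj_zero (x : 𝕊 2) : halfTurnConj (x, 0) = (axisRotDiffeo π x, 0) := by
  simp

end Conj

/-! ### Reparametrised knots and tubular neighbourhoods -/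

namespace SphereEmbedding

variable {k n : ℕ}

/-- The **reparametrised sphere embedding** `K ∘ φ` for a diffeomorphism `φ` of the source sphere
(same image, possibly different orientation/parametrisation). Rolfsen, *Knots and Links* (1976),
§1.A. [folklore] -/
def precomp (K : SphereEmbedding k n) (φ : (𝕊 k) ≃ₘ⟮𝓡 k, 𝓡 k⟯ (𝕊 k)) : SphereEmbedding k n :=
  ⟨K ∘ φ, K.isSmoothEmbedding.comp_diffeomorph φ⟩

/-- The reparametrised embedding as a function. [folklore] -/
@[simp]
theorem coe_precomp (K : SphereEmbedding k n) (φ : (𝕊 k) ≃ₘ⟮𝓡 k, 𝓡 k⟯ (𝕊 k)) :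
    ⇑(K.precomp φ) = K ∘ φ := rfl

/-- Reparametrisation does not change the image. [folklore] -/
theorem range_precomp (K : SphereEmbedding k n) (φ : (𝕊 k) ≃ₘ⟮𝓡 k, 𝓡 k⟯ (𝕊 k)) :
    range (K.precomp φ) = range K := by
  have hφ : Surjective (φ : (𝕊 k) → 𝕊 k) := φ.surjective
  rw [coe_precomp, hφ.range_comp]

/-- Reparametrisation does not change the complement. [folklore] -/
theorem complement_precomp (K : SphereEmbedding k n) (φ : (𝕊 k) ≃ₘ⟮𝓡 k, 𝓡 k⟯ (𝕊 k)) :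
    (K.precomp φ).complement = K.complement :=
  TopologicalSpace.Opens.ext (by simp only [complement, range_precomp, TopologicalSpace.Opens.coe_mk])

end SphereEmbedding

namespace TwoKnot.TubularNbhd

variable {K : TwoKnot}

/-- The **reparametrised tubular neighbourhood** `ν ∘ Φ` for a diffeomorphism `Φ` of `S² × ℝ²`
mapping the zero section to itself over a diffeomorphism `φ` of `S²` (`Φ (x, 0) = (φ x, 0)`): a
tubular neighbourhood of the reparametrised knot `K ∘ φ`. [folklore] -/
def reparam (ν : TwoKnot.TubularNbhd K)
    (Φ : ((𝕊 2) × 𝔼 2) ≃ₘ⟮(𝓡 2).prod 𝓘(ℝ, 𝔼 2), (𝓡 2).prod 𝓘(ℝ, 𝔼 2)⟯ ((𝕊 2) × 𝔼 2))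
    (φ : (𝕊 2) ≃ₘ⟮𝓡 2, 𝓡 2⟯ (𝕊 2)) (hΦ : ∀ x, Φ (x, 0) = (φ x, 0)) :
    TwoKnot.TubularNbhd (K.precomp φ) where
  toFun := ν.toFun ∘ Φ
  isSmoothEmbedding := ν.isSmoothEmbedding.comp_diffeomorph Φ
  apply_zero x := by simp only [comp_apply, hΦ, ν.apply_zero, SphereEmbedding.coe_precomp]

/-- The reparametrised tubular neighbourhood as a function. [folklore] -/
@[simp]
theorem reparam_toFun (ν : TwoKnot.TubularNbhd K)
    (Φ : ((𝕊 2) × 𝔼 2) ≃ₘ⟮(𝓡 2).prod 𝓘(ℝ, 𝔼 2), (𝓡 2).prod 𝓘(ℝ, 𝔼 2)⟯ ((𝕊 2) × 𝔼 2))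
    (φ : (𝕊 2) ≃ₘ⟮𝓡 2, 𝓡 2⟯ (𝕊 2)) (hΦ : ∀ x, Φ (x, 0) = (φ x, 0)) :
    (ν.reparam Φ φ hΦ).toFun = ν.toFun ∘ Φ := rfl

end TwoKnot.TubularNbhd

section Reparam

variable {EX HX : Type*} [NormedAddCommGroup EX] [NormedSpace ℝ EX] [TopologicalSpace HX]
  {IX : ModelWithCorners ℝ EX HX} {X : Type*} [TopologicalSpace X] [ChartedSpace HX X]
  {K : TwoKnot}

/-- **Re-gluing through a symmetry of the Gluck map.** If `X` is an open gluing of `S⁴ ∖ K(S²)`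
and `S² × ℝ²` along `gluckRel ν`, and `Φ` is a diffeomorphism of `S² × ℝ²` over `φ` on the zero
section which commutes with the Gluck map, then `X` is also an open gluing of
`S⁴ ∖ (K ∘ φ)(S²) = S⁴ ∖ K(S²)` and `S² × ℝ²` along `gluckRel (ν ∘ Φ)` (replace `jB` by `jB ∘ Φ`).
Applied to the half-turn-and-conjugate involution `ι` this identifies the Gluck twist formed with
the fibre-orientation-reversed tubular neighbourhood `ν ∘ (id × conj)` (i.e. with `τ⁻¹`) with a
Gluck twist of the reparametrised knot `K ∘ σ'` (Gluck 1962, §8: `τ` and `τ⁻¹` give the same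
construction). [folklore] -/
theorem isOpenGluing_gluckRel_reparam {ν : TwoKnot.TubularNbhd K}
    (h : IsOpenGluing (𝓡 4) ((𝓡 2).prod 𝓘(ℝ, 𝔼 2)) IX (A := K.complement) (B := (𝕊 2) × 𝔼 2)
      (P := X) (gluckRel ν))
    (Φ : ((𝕊 2) × 𝔼 2) ≃ₘ⟮(𝓡 2).prod 𝓘(ℝ, 𝔼 2), (𝓡 2).prod 𝓘(ℝ, 𝔼 2)⟯ ((𝕊 2) × 𝔼 2))
    (φ : (𝕊 2) ≃ₘ⟮𝓡 2, 𝓡 2⟯ (𝕊 2)) (hΦ : ∀ x, Φ (x, 0) = (φ x, 0))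
    (hcomm : ∀ p : (𝕊 2) × 𝔼 2, gluckMap (Φ p) = Φ (gluckMap p))
    (hzero : ∀ p : (𝕊 2) × 𝔼 2, (Φ p).2 = 0 ↔ p.2 = 0) :
    IsOpenGluing (𝓡 4) ((𝓡 2).prod 𝓘(ℝ, 𝔼 2)) IX (A := (K.precomp φ).complement)
      (B := (𝕊 2) × 𝔼 2) (P := X) (gluckRel (ν.reparam Φ φ hΦ)) := by
  -- generalise over the open set carrying the first piece, then identify it with `K.complement`
  suffices H : ∀ (U : TopologicalSpace.Opens (𝕊 4)) (hU : U = K.complement),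
      IsOpenGluing (𝓡 4) ((𝓡 2).prod 𝓘(ℝ, 𝔼 2)) IX (A := U) (B := (𝕊 2) × 𝔼 2) (P := X)
        fun a b => b.2 ≠ 0 ∧ (a : 𝕊 4) = ν.toFun (Φ (gluckMap b)) by
    have h' := H _ (SphereEmbedding.complement_precomp K φ)
    have hrel : (fun (a : (K.precomp φ).complement) (b : (𝕊 2) × 𝔼 2) =>
        b.2 ≠ 0 ∧ (a : 𝕊 4) = ν.toFun (Φ (gluckMap b))) = gluckRel (ν.reparam Φ φ hΦ) := by
      funext a b
      rfl
    rwa [hrel] at h'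
  intro U hU
  subst hU
  obtain ⟨jA, jB, hA, hAo, hB, hBo, hU, hR⟩ := h
  have hΦs : Surjective (Φ : (𝕊 2) × 𝔼 2 → (𝕊 2) × 𝔼 2) := Φ.surjective
  refine ⟨jA, jB ∘ Φ, hA, hAo, hB.comp_diffeomorph Φ, ?_, ?_, fun a b => ?_⟩
  · rwa [hΦs.range_comp]
  · rwa [hΦs.range_comp]
  · rw [comp_apply, hR]
    simp only [gluckRel, hcomm, ne_eq, hzero]

end Reparam

/-! ### Smooth angle functions for smooth maps `S² → S¹` -/

section AngleLift

/-- **Smooth angle functions on the 2-sphere.** A smooth map `u : S² → ℝ²` with values in the unit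
circle has a smooth angle function `β : S² → ℝ`, `u = (cos β, sin β)`: a continuous logarithm of
`u` viewed in `ℂ ∖ {0}` exists because `S²` is simply connected (lifting criterion, Hatcher,
*Algebraic Topology*, Prop. 1.33, here through Mathlib's `Complex.exists_continuousOn_eqOn_exp_comp`
and the tree's `simplyConnectedSpace_euclideanSphere`), and it is smooth because locally it
differs from a branch of `log ∘ u` by a constant. [folklore] -/
theorem exists_contMDiff_angle {u : (𝕊 2) → 𝔼 2} (hu : ContMDiff (𝓡 2) 𝓘(ℝ, 𝔼 2) ∞ u)
    (hu1 : ∀ x, ‖u x‖ = 1) :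
    ∃ β : (𝕊 2) → ℝ, ContMDiff (𝓡 2) 𝓘(ℝ, ℝ) ∞ β ∧
      ∀ x, u x 0 = Real.cos (β x) ∧ u x 1 = Real.sin (β x) := by
  -- the map viewed in `ℂ`
  set U : (𝕊 2) → ℂ := fun x => (u x 0 : ℂ) + Complex.I * (u x 1 : ℂ) with hU
  have hu0 : ContMDiff (𝓡 2) 𝓘(ℝ, ℝ) ∞ fun x => u x 0 :=
    (EuclideanSpace.proj (𝕜 := ℝ) (0 : Fin 2)).contDiff.contMDiff.comp hu
  have hu1' : ContMDiff (𝓡 2) 𝓘(ℝ, ℝ) ∞ fun x => u x 1 :=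
    (EuclideanSpace.proj (𝕜 := ℝ) (1 : Fin 2)).contDiff.contMDiff.comp hu
  have hUs : ContMDiff (𝓡 2) 𝓘(ℝ, ℂ) ∞ U := by
    have h0 : ContMDiff (𝓡 2) 𝓘(ℝ, ℂ) ∞ fun x => (u x 0 : ℂ) :=
      Complex.ofRealCLM.contDiff.contMDiff.comp hu0
    have h1 : ContMDiff (𝓡 2) 𝓘(ℝ, ℂ) ∞ fun x => (u x 1 : ℂ) :=
      Complex.ofRealCLM.contDiff.contMDiff.comp hu1'
    have h1' : ContMDiff (𝓡 2) 𝓘(ℝ, ℂ) ∞ fun x => Complex.I * (u x 1 : ℂ) :=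
      ((Complex.I • ContinuousLinearMap.id ℝ ℂ).contDiff.contMDiff).comp h1
    exact h0.add h1'
  have hUre : ∀ x, (U x).re = u x 0 := fun x => by simp [hU]
  have hUim : ∀ x, (U x).im = u x 1 := fun x => by simp [hU]
  have hUnorm : ∀ x, ‖U x‖ = 1 := by
    intro x
    have h := hu1 x
    rw [EuclideanSpace.norm_eq, Real.sqrt_eq_one, Fin.sum_univ_two] at h
    simp only [Real.norm_eq_abs, sq_abs] at h
    rw [Complex.norm_def, Complex.normSq_apply, hUre, hUim, Real.sqrt_eq_one]
    nlinarith [h]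
  have hU0 : ∀ x, U x ≠ 0 := fun x h => by simpa [h] using hUnorm x
  -- a continuous logarithm on the simply connected sphere
  haveI : LocallyPathConnectedSpace (𝕊 2) := ChartedSpace.locallyPathConnectedSpace (𝔼 2) (𝕊 2)
  have hsc : IsSimplyConnected (univ : Set (𝕊 2)) := by
    haveI := simplyConnectedSpace_euclideanSphere (n := 2) le_rfl
    exact (Homeomorph.Set.univ (𝕊 2)).toHomotopyEquiv.simplyConnectedSpace_iff.2 ‹_›
  obtain ⟨L, hLc, hLexp⟩ := Complex.exists_continuousOn_eqOn_exp_comp hsc isOpen_univ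
    hUs.continuous.continuousOn (by simpa using fun x => hU0 x)
  have hLexp' : ∀ x, Complex.exp (L x) = U x := fun x => hLexp (mem_univ x)
  have hLre : ∀ x, (L x).re = 0 := by
    intro x
    have h := congrArg norm (hLexp' x)
    rw [Complex.norm_exp, hUnorm] at h
    exact Real.exp_eq_one_iff _ |>.1 h
  refine ⟨fun x => (L x).im, fun x₁ => ?_, fun x => ?_⟩
  · -- smoothness at `x₁`: compare with the local branch `L x₁ + log (U x / U x₁)`
    have hdiv : ContMDiff (𝓡 2) 𝓘(ℝ, ℂ) ∞ fun x => (U x₁)⁻¹ * U x :=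
      (((U x₁)⁻¹ • ContinuousLinearMap.id ℝ ℂ).contDiff.contMDiff).comp hUs
    set W : Set (𝕊 2) := (fun x => (U x₁)⁻¹ * U x) ⁻¹' Complex.slitPlane with hW
    have hWo : IsOpen W := Complex.isOpen_slitPlane.preimage hdiv.continuous
    have hx₁W : x₁ ∈ W := by
      simp only [hW, mem_preimage, inv_mul_cancel₀ (hU0 x₁)]
      exact Complex.one_mem_slitPlane
    set V : Set (𝕊 2) := connectedComponentIn W x₁ with hV
    have hVo : IsOpen V := hWo.connectedComponentIn
    have hVc : IsPreconnected V := isPreconnected_connectedComponentIn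
    have hx₁V : x₁ ∈ V := mem_connectedComponentIn hx₁W
    have hVW : V ⊆ W := connectedComponentIn_subset _ _
    set L' : (𝕊 2) → ℂ := fun x => L x₁ + Complex.log ((U x₁)⁻¹ * U x) with hL'
    have hL'exp : ∀ x, Complex.exp (L' x) = U x := by
      intro x
      rw [hL', Complex.exp_add, hLexp' x₁,
        Complex.exp_log (mul_ne_zero (inv_ne_zero (hU0 x₁)) (hU0 x)),
        mul_inv_cancel_left₀ (hU0 x₁)]
    have hlogA : ∀ x ∈ V, ContMDiffAt (𝓡 2) 𝓘(ℝ, ℂ) ∞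
        (fun x => Complex.log ((U x₁)⁻¹ * U x)) x := fun x hx =>
      ((Complex.contDiffAt_log (hVW hx)).restrict_scalars ℝ).contMDiffAt.comp x (hdiv x)
    have hL'A : ∀ x ∈ V, ContMDiffAt (𝓡 2) 𝓘(ℝ, ℂ) ∞ L' x := fun x hx =>
      contMDiffAt_const.add (hlogA x hx)
    have hL'c : ContinuousOn L' V :=
      continuousOn_of_forall_continuousAt fun x hx => (hL'A x hx).continuousAt
    obtain ⟨n, hn⟩ := PlaneTopology.exists_int_eq_add_of_exp_eq hVc (hLc.mono (subset_univ _)) hL'c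
      fun x _ => by rw [hLexp', hL'exp]
    have hn0 : (n : ℂ) * (2 * π * Complex.I) = 0 := by
      have h := hn x₁ hx₁V
      have hL'x₁ : L' x₁ = L x₁ := by
        show L x₁ + Complex.log ((U x₁)⁻¹ * U x₁) = L x₁
        rw [inv_mul_cancel₀ (hU0 x₁), Complex.log_one, add_zero]
      rw [hL'x₁] at h
      linear_combination -h
    have hLL' : ∀ x ∈ V, L x = L' x := fun x hx => by rw [hn x hx, hn0, add_zero]
    have him : ContMDiffAt (𝓡 2) 𝓘(ℝ, ℝ) ∞ (fun x => (L' x).im) x₁ :=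
      (Complex.imCLM.contDiff.contMDiff.contMDiffAt).comp x₁ (hL'A x₁ hx₁V)
    refine him.congr_of_eventuallyEq ?_
    filter_upwards [hVo.mem_nhds hx₁V] with x hx
    simp only [hLL' x hx]
  · have h := hLexp' x
    have hre := congrArg Complex.re h
    have him := congrArg Complex.im h
    rw [Complex.exp_re, hLre, Real.exp_zero, one_mul, hUre] at hre
    rw [Complex.exp_im, hLre, Real.exp_zero, one_mul, hUim] at him
    exact ⟨hre.symm, him.symm⟩

end AngleLift

/-! ### Smooth families of linear isometries of the plane -/

section IsometryFamily

/-- The 2-sphere is preconnected. [folklore] -/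
theorem preconnectedSpace_sphereTwo : PreconnectedSpace (𝕊 2) := by
  have h : IsPreconnected (Metric.sphere (0 : 𝔼 3) 1) := by
    apply isPreconnected_sphere
    rw [← Module.finrank_eq_rank, finrank_euclideanSpace_fin]
    norm_num
  exact isPreconnected_iff_preconnectedSpace.mp h

/-- **A linear isometry of the plane is a rotation or a rotation composed with conjugation**, in
the form needed here: if `A e₀ = (cos θ, sin θ)` then `A w = R(θ) w` for all `w` or
`A w = R(θ) w̄` for all `w`, according to the sign `ε = det A = ±1`, and in fact
`A e₁ = ε J (A e₀)`. Pointwise algebraic version: for unit vectors `u ⊥ v` of `ℝ²`,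
`v = ε J u` with `ε = v₁ u₀ - v₀ u₁`, `ε² = 1`. [folklore] -/
theorem eq_smul_quarterTurn_of_inner_eq_zero {u v : 𝔼 2} (hu : ‖u‖ = 1) (hv : ‖v‖ = 1)
    (huv : inner ℝ v u = 0) :
    v = (v 1 * u 0 - v 0 * u 1) • quarterTurn u ∧ (v 1 * u 0 - v 0 * u 1) ^ 2 = 1 := by
  rw [EuclideanSpace.norm_eq, Real.sqrt_eq_one, Fin.sum_univ_two] at hu hv
  simp only [Real.norm_eq_abs, sq_abs] at hu hv
  have huv' : v 0 * u 0 + v 1 * u 1 = 0 := by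
    simpa [PiLp.inner_apply, Fin.sum_univ_two, mul_comm] using huv
  refine ⟨?_, ?_⟩
  · ext i
    fin_cases i
    · simp only [Fin.zero_eta, PiLp.smul_apply, smul_eq_mul, quarterTurn]
      simp
      linear_combination (-(v 0)) * hu + u 0 * huv'
    · simp only [Fin.mk_one, PiLp.smul_apply, smul_eq_mul, quarterTurn]
      simp
      linear_combination (-(v 1)) * hu + u 1 * huv'
  · linear_combination (v 0 ^ 2 + v 1 ^ 2) * hu + hv - (v 0 * u 0 + v 1 * u 1) * huv'

/-- A rotation in terms of the unit vector `u = (cos θ, sin θ)`: `R(θ) w = w₀ u + w₁ J u`.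
[folklore] -/
theorem rotPlane_eq_of_cos_sin {θ : ℝ} {u : 𝔼 2} (h0 : u 0 = Real.cos θ) (h1 : u 1 = Real.sin θ)
    (w : 𝔼 2) : rotPlane θ w = w 0 • u + w 1 • quarterTurn u := by
  ext i
  fin_cases i
  · simp [quarterTurn, h0, h1]
    ring
  · simp [quarterTurn, h0, h1]
    ring

/-- **Smooth families of linear isometries of `ℝ²` over `S²` are families of rotations, possibly
composed with conjugation, by a smooth angle function.** Given `g : S² → O(2)` with
`(x, w) ↦ g x w` smooth, there is a smooth `β : S² → ℝ` with either `g x = R(β x)` for all `x`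
(all `g x ∈ SO(2)`) or `g x = R(β x) ∘ conj` for all `x` (all `g x ∉ SO(2)`): the determinant
`±1` is continuous hence constant on the connected `S²`, and the first column `x ↦ g x e₀` lifts
to an angle function (`exists_contMDiff_angle`, `π₁(S²) = 1`). This is the `π₂(O(2)) = 0`-type
input making bundle automorphisms of `S² × ℝ²` isotopic to constant ones. [folklore] -/
theorem exists_angle_of_linearIsometry_family {g : (𝕊 2) → (𝔼 2 ≃ₗᵢ[ℝ] 𝔼 2)}
    (hg : ContMDiff ((𝓡 2).prod 𝓘(ℝ, 𝔼 2)) 𝓘(ℝ, 𝔼 2) ∞ fun p : (𝕊 2) × 𝔼 2 => g p.1 p.2) :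
    ∃ β : (𝕊 2) → ℝ, ContMDiff (𝓡 2) 𝓘(ℝ, ℝ) ∞ β ∧
      ((∀ x w, g x w = rotPlane (β x) w) ∨ (∀ x w, g x w = rotPlane (β x) (conjPlane w))) := by
  set e₀ : 𝔼 2 := EuclideanSpace.single 0 1 with he₀
  set e₁ : 𝔼 2 := EuclideanSpace.single 1 1 with he₁
  set u : (𝕊 2) → 𝔼 2 := fun x => g x e₀ with hu
  set v : (𝕊 2) → 𝔼 2 := fun x => g x e₁ with hv
  have hus : ContMDiff (𝓡 2) 𝓘(ℝ, 𝔼 2) ∞ u := hg.comp (contMDiff_id.prodMk contMDiff_const)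
  have hvs : ContMDiff (𝓡 2) 𝓘(ℝ, 𝔼 2) ∞ v := hg.comp (contMDiff_id.prodMk contMDiff_const)
  have hu1 : ∀ x, ‖u x‖ = 1 := fun x => by simp [hu, he₀]
  have hv1 : ∀ x, ‖v x‖ = 1 := fun x => by simp [hv, he₁]
  have huv : ∀ x, inner ℝ (v x) (u x) = 0 := fun x => by
    simp [hu, hv, he₀, he₁, LinearIsometryEquiv.inner_map_map, EuclideanSpace.inner_single_left]
  obtain ⟨β, hβ, hβu⟩ := exists_contMDiff_angle hus hu1
  -- the determinant sign
  set ε : (𝕊 2) → ℝ := fun x => v x 1 * u x 0 - v x 0 * u x 1 with hε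
  have hvε : ∀ x, v x = ε x • quarterTurn (u x) ∧ ε x ^ 2 = 1 := fun x =>
    eq_smul_quarterTurn_of_inner_eq_zero (hu1 x) (hv1 x) (huv x)
  have hεc : Continuous ε := by
    have hc : ∀ (f : (𝕊 2) → 𝔼 2), Continuous f → ∀ i : Fin 2, Continuous fun x => f x i :=
      fun f hf i => (EuclideanSpace.proj (𝕜 := ℝ) i).continuous.comp hf
    exact ((hc v hvs.continuous 1).mul (hc u hus.continuous 0)).sub
      ((hc v hvs.continuous 0).mul (hc u hus.continuous 1))
  haveI := preconnectedSpace_sphereTwo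
  have hε1 : EqOn ε 1 univ ∨ EqOn ε (-1) univ :=
    isPreconnected_univ.eq_one_or_eq_neg_one_of_sq_eq hεc.continuousOn fun x _ => by
      simpa using (hvε x).2
  -- linearity of `g x` on the basis `e₀`, `e₁`
  have hlin : ∀ x w, g x w = w 0 • u x + w 1 • v x := by
    intro x w
    have hw : w = w 0 • e₀ + w 1 • e₁ := by
      ext i
      fin_cases i <;> simp [he₀, he₁]
    conv_lhs => rw [hw]
    simp only [map_add, map_smul, hu, hv]
  refine ⟨β, hβ, ?_⟩
  rcases hε1 with h1 | h1
  · left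
    intro x w
    rw [hlin, (hvε x).1, h1 (mem_univ x), Pi.one_apply, one_smul,
      rotPlane_eq_of_cos_sin (hβu x).1 (hβu x).2]
  · right
    intro x w
    rw [hlin, (hvε x).1, h1 (mem_univ x), Pi.neg_apply, Pi.one_apply, neg_one_smul,
      rotPlane_eq_of_cos_sin (hβu x).1 (hβu x).2]
    simp

end IsometryFamily

end Literature.Topology.FourManifolds

end
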